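import Literature.AnabelianGeometry.EtaleTheta.DivisorMonoids
import Literature.AnabelianGeometry.EtaleTheta.MonoprimeStructure
import Literature.AlgebraicGeometry.Frobenioids.PerfFactorialSupports
import Literature.AlgebraicGeometry.Frobenioids.PerfFactorialPerfection
import Literature.AlgebraicGeometry.Frobenioids.PerfectionDivisorial

/-!
# [EtTh] Definition 3.1 (i) / 3.3 (iii): the support calculus of non-cuspidal and cuspidal
# log-divisors in `Φ₀(Y)` — PROVED from the unique decomposition of Definition 3.3 (iii)

Mochizuki, *The étale theta function …*, Publ. RIMS **45** (2009), Def. 3.1 (i), PDF p.70 (printed 296)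
[cite: MochizukiEtTh2009, Def 3.1 p.70]: "A divisor on `Z_∞` whose support lies in the special fiber
(respectively, the divisor of cusps of `Z^log_∞`; the union of the special fiber and divisor of cusps of
`Z^log_∞`) will be referred to as a non-cuspidal log-divisor (respectively, cuspidal log-divisor;
log-divisor)"; Def. 3.3 (iii) p.73 (`Φ₀(Y) = lim Div⁺(Z^log_∞)^{Gal}`), typed by abc-iut-L2-t3 as the data
`DivisorMonoids` whose field `existsUnique_ncsp_csp` records "every element of `Φ₀(Y)` is uniquely a
non-cuspidal times a cuspidal one".

abc-iut cell, layer L2 (prover abc-iut-L2-d2).  THIS FILE (theorems only) derives from that ONE field,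
for `Φ₀(Y)` sharp (resp. perf-factorial — Prop. 3.4 (i)), the "support" facts every consumer of
Def. 3.6 (iii)/(v) and Cor. 3.8 (iii) needs and which a constructor of the realified data (Def. 3.6 (i),
abc-iut-L6-t12's `RealifiedDivisorMonoids.ofRlfZ`) has to supply at the level of `Φ₀^ℝ`:
`ncsp₀ ⊓ csp₀ = ⊥`; down-closure of `ncsp₀`, `csp₀` under `≤` and `≼`; every primary element of `Φ₀(Y)`
is non-cuspidal or cuspidal, uniformly on its prime; in a perf-factorial monoid every `x ≠ 0` lies `≽`
some primary element (`exists_isPrimary_precsim`, [FrdI] Def. 2.4 (i)(c)); hence the SUPPORT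
CHARACTERISATION `x ∈ ncsp₀ ⟺ every primary y ≼ x is in ncsp₀` (and for `csp₀`) — the hypotheses
`hDa`/`hDn`/`hDc` of `Discharge/Sec3CuspidalPreSteps.lean` at the level of `Φ₀`.
Monoids multiplicative (`x ∣ y` is print's `x ≤ y`, `≼` = `Precsim`).
HONEST FRAMING: refereed pre-IUT material; nothing here bears on [IUTchIII] Cor. 3.12.
-/

namespace Literature.AlgebraicGeometry.Frobenioids

universe u

/-- **The prime-targeted form of [FrdI] Def. 2.4 (i)(c)**: if the factorization of `c ∈ M` is nonzero
at the prime `𝔮` of `M^pf`, then some primary `m ∈ M` whose image lies in `𝔮` satisfies `m ≼ c` (some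
element of `𝔮` divides `c` in `M^pf` — else `Bound_{𝔮 ∪ {0}}(c) = {0}` —; a suitable power of it lies in
`M`). [cite: MochizukiFrdI2008, Def. 2.4(i) p.47] -/
theorem IsPerfFactorial.exists_isPrimary_precsim_of_factorMap_ne_one {M : Type u} [CommMonoid M]
    (h : IsPerfFactorial M) {c : M} {𝔮 : Primes (Perfection M)}
    (h𝔮 : factorMap M (Perfection.of M c) 𝔮 ≠ 1) :
    ∃ m : M, IsPrimary m ∧ Perfection.of M m ∈ 𝔮.carrier ∧ Precsim m c := by
  have hM : IsSharp M := h.isDivisorial.isSharp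
  have hMpf : IsSharp (Perfection M) := h.isDivisorial.perfection.isSharp
  -- some element of `𝔮` divides `c` in `M^pf`
  have hx : ∃ x : PfAt M 𝔮, x.1 ∈ 𝔮.carrier ∧ x.1 ∣ Perfection.of M c := by
    by_contra hne
    push Not at hne
    apply h𝔮
    have hb : IsBoundedBy (boundAt M 𝔮 (Perfection.of M c)) 1 := by
      rintro y ⟨x, hx𝔮, hxc, rfl⟩
      rcases hx𝔮 with hx𝔮 | hx1
      · exact absurd hxc (hne x hx𝔮)
      · have : x = 1 := Subtype.ext hx1
        rw [this, map_one]
    have h1 := h.factorMap_dvd_of_isBoundedBy hb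
    exact (Literature.AnabelianGeometry.EtaleTheta.MonoprimeStructure.isSharp
      (IsMonoprime.ofR (h.isRMonoprime_rlfAt 𝔮))).eq_one_of_isUnit _ (isUnit_of_dvd_one h1)
  obtain ⟨x, hxp, hxc⟩ := hx
  obtain ⟨⟨m, k⟩, hmk⟩ := Perfection.mk_surjective x.1
  dsimp only at hmk
  have hpow : x.1 ^ (k : ℕ) = Perfection.of M m := by rw [← hmk, Perfection.mk_pow_self]
  refine ⟨m, (Perfection.isPrimary_of_iff hM).1 (hpow ▸ (hxp.1.pow hMpf k.pos)),
    hpow ▸ Primes.pow_mem_carrier hMpf 𝔮 hxp k.pos, ?_⟩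
  rw [← Perfection.of_precsim_of_iff, ← hpow]
  exact ⟨k, k.pos, pow_dvd_pow_of_dvd hxc _⟩

/-- **In a perf-factorial monoid every `c ≠ 0` satisfies `m ≼ c` for some primary `m`** ([FrdI]
Def. 2.4 (i)(c): the factorization of `c` is injective, hence nonzero at some prime).
[cite: MochizukiFrdI2008, Def. 2.4(i) p.47] -/
theorem IsPerfFactorial.exists_isPrimary_precsim {M : Type u} [CommMonoid M] (h : IsPerfFactorial M)
    {c : M} (hc : c ≠ 1) : ∃ m : M, IsPrimary m ∧ Precsim m c := by
  have hoc : Perfection.of M c ≠ 1 := by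
    rw [Perfection.of_apply]
    exact fun e => hc ((Perfection.mk_eq_one_iff_of_isSharp h.isDivisorial.isSharp).1 e)
  obtain ⟨𝔮, h𝔮⟩ := h.exists_factorMap_apply_ne_one hoc
  obtain ⟨m, hm, -, hmc⟩ := h.exists_isPrimary_precsim_of_factorMap_ne_one h𝔮
  exact ⟨m, hm, hmc⟩

end Literature.AlgebraicGeometry.Frobenioids

namespace Literature.AnabelianGeometry.EtaleTheta

namespace DivisorMonoids

open CategoryTheory Opposite Literature.AlgebraicGeometry.Frobenioids

universe u v w

variable {D₀ : Type u} [Category.{v} D₀] (T : DivisorMonoids.{u, v, w} D₀) (Y : D₀ᵒᵖ)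

/-- `Φ₀(Y)^ncsp ∩ Φ₀(Y)^csp = 0`: an element both non-cuspidal and cuspidal is `0` (uniqueness in
Def 3.3 (iii)'s decomposition: `x = x·0 = 0·x`). [cite: MochizukiEtTh2009, Def 3.3 p.73] -/
theorem eq_one_of_mem_ncsp₀_of_mem_csp₀ {x : T.Φ₀.obj Y} (hn : x ∈ T.ncsp₀ Y) (hc : x ∈ T.csp₀ Y) :
    x = 1 := by
  obtain ⟨p, -, hu⟩ := T.existsUnique_ncsp_csp Y x
  have h1 := hu (⟨x, hn⟩, (1 : T.csp₀ Y)) (by simp)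
  have h2 := hu ((1 : T.ncsp₀ Y), ⟨x, hc⟩) (by simp)
  have := congrArg (fun q : T.ncsp₀ Y × T.csp₀ Y => (q.1 : T.Φ₀.obj Y)) (h1.trans h2.symm)
  simpa using this

/-- `Φ₀(Y)^ncsp ⊓ Φ₀(Y)^csp = ⊥`. [cite: MochizukiEtTh2009, Def 3.3 p.73] -/
theorem ncsp₀_inf_csp₀ : T.ncsp₀ Y ⊓ T.csp₀ Y = ⊥ :=
  le_bot_iff.1 fun _ hx => (Submonoid.mem_bot).2 (T.eq_one_of_mem_ncsp₀_of_mem_csp₀ Y hx.1 hx.2)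

/-- **Down-closure of the non-cuspidal log-divisors** (`Φ₀(Y)` sharp): if `x ≤ n` and `n` is
non-cuspidal, so is `x` (support in the special fibre). [cite: MochizukiEtTh2009, Def 3.1 p.70] -/
theorem mem_ncsp₀_of_dvd (hS : IsSharp (T.Φ₀.obj Y)) {x n : T.Φ₀.obj Y} (hxn : x ∣ n)
    (hn : n ∈ T.ncsp₀ Y) : x ∈ T.ncsp₀ Y := by
  obtain ⟨z, rfl⟩ := hxn
  obtain ⟨⟨a, c⟩, hac, -⟩ := T.existsUnique_ncsp_csp Y x
  obtain ⟨⟨a', c'⟩, hac', -⟩ := T.existsUnique_ncsp_csp Y z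
  obtain ⟨p, -, hu⟩ := T.existsUnique_ncsp_csp Y (x * z)
  have h1 := hu (⟨x * z, hn⟩, (1 : T.csp₀ Y)) (by simp)
  have h2 := hu (a * a', c * c') (by
    simp only [Submonoid.coe_mul]
    rw [← hac, ← hac']
    simp only [mul_mul_mul_comm])
  have hcc : ((c * c' : T.csp₀ Y) : T.Φ₀.obj Y) = 1 := by
    have := congrArg (fun q : T.ncsp₀ Y × T.csp₀ Y => (q.2 : T.Φ₀.obj Y)) (h2.trans h1.symm)
    simpa using this
  have hc1 : (c : T.Φ₀.obj Y) = 1 :=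
    hS.eq_one_of_isUnit _ (IsUnit.of_mul_eq_one (c' : T.Φ₀.obj Y) (by simpa using hcc))
  rw [← hac, hc1, mul_one]
  exact a.2

/-- **Down-closure of the cuspidal log-divisors** (`Φ₀(Y)` sharp). [cite: MochizukiEtTh2009, Def 3.1 p.70] -/
theorem mem_csp₀_of_dvd (hS : IsSharp (T.Φ₀.obj Y)) {x c : T.Φ₀.obj Y} (hxc : x ∣ c)
    (hc : c ∈ T.csp₀ Y) : x ∈ T.csp₀ Y := by
  obtain ⟨z, rfl⟩ := hxc
  obtain ⟨⟨a, d⟩, had, -⟩ := T.existsUnique_ncsp_csp Y x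
  obtain ⟨⟨a', d'⟩, had', -⟩ := T.existsUnique_ncsp_csp Y z
  obtain ⟨p, -, hu⟩ := T.existsUnique_ncsp_csp Y (x * z)
  have h1 := hu ((1 : T.ncsp₀ Y), ⟨x * z, hc⟩) (by simp)
  have h2 := hu (a * a', d * d') (by
    simp only [Submonoid.coe_mul]
    rw [← had, ← had']
    simp only [mul_mul_mul_comm])
  have haa : ((a * a' : T.ncsp₀ Y) : T.Φ₀.obj Y) = 1 := by
    have := congrArg (fun q : T.ncsp₀ Y × T.csp₀ Y => (q.1 : T.Φ₀.obj Y)) (h2.trans h1.symm)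
    simpa using this
  have ha1 : (a : T.Φ₀.obj Y) = 1 :=
    hS.eq_one_of_isUnit _ (IsUnit.of_mul_eq_one (a' : T.Φ₀.obj Y) (by simpa using haa))
  rw [← had, ha1, one_mul]
  exact d.2

/-- Down-closure under `≼` for non-cuspidal log-divisors. [cite: MochizukiEtTh2009, Def 3.1 p.70] -/
theorem mem_ncsp₀_of_precsim (hS : IsSharp (T.Φ₀.obj Y)) {x n : T.Φ₀.obj Y} (hxn : Precsim x n)
    (hn : n ∈ T.ncsp₀ Y) : x ∈ T.ncsp₀ Y := by
  obtain ⟨k, -, hk⟩ := hxn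
  exact T.mem_ncsp₀_of_dvd Y hS hk (pow_mem hn k)

/-- Down-closure under `≼` for cuspidal log-divisors. [cite: MochizukiEtTh2009, Def 3.1 p.70] -/
theorem mem_csp₀_of_precsim (hS : IsSharp (T.Φ₀.obj Y)) {x c : T.Φ₀.obj Y} (hxc : Precsim x c)
    (hc : c ∈ T.csp₀ Y) : x ∈ T.csp₀ Y := by
  obtain ⟨k, -, hk⟩ := hxc
  exact T.mem_csp₀_of_dvd Y hS hk (pow_mem hc k)

/-- **Every primary element of `Φ₀(Y)` is non-cuspidal or cuspidal** (`Φ₀(Y)` sharp): a prime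
log-divisor is an irreducible component of the special fibre or a cusp (Def 3.1 (i); Rmk 3.3.1).
[cite: MochizukiEtTh2009, Rmk 3.3.1 p.73] -/
theorem mem_ncsp₀_or_mem_csp₀_of_isPrimary (hS : IsSharp (T.Φ₀.obj Y)) {e : T.Φ₀.obj Y}
    (he : IsPrimary e) : e ∈ T.ncsp₀ Y ∨ e ∈ T.csp₀ Y := by
  obtain ⟨⟨a, c⟩, hac, -⟩ := T.existsUnique_ncsp_csp Y e
  by_cases ha : (a : T.Φ₀.obj Y) = 1
  · right
    rw [← hac, ha, one_mul]
    exact c.2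
  · -- `a ≼ e` and `e` primary give `e ≼ a`, so `e` is non-cuspidal
    left
    have hae : Precsim (a : T.Φ₀.obj Y) e := Precsim.of_dvd ⟨c, hac.symm⟩
    exact T.mem_ncsp₀_of_precsim Y hS (he.2 _ ha hae) a.2

/-- Non-cuspidality is constant on `≼`-classes of primary elements: the prime of a non-cuspidal primary
element consists of non-cuspidal elements. [cite: MochizukiEtTh2009, Def 3.6 p.77] -/
theorem mem_ncsp₀_of_mem_carrier (hS : IsSharp (T.Φ₀.obj Y)) (𝔭 : Primes (T.Φ₀.obj Y))
    {e e' : T.Φ₀.obj Y} (he : e ∈ 𝔭.carrier) (he' : e' ∈ 𝔭.carrier) (hn : e ∈ T.ncsp₀ Y) :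
    e' ∈ T.ncsp₀ Y :=
  T.mem_ncsp₀_of_precsim Y hS (𝔭.precsim_of_mem_carrier he' he) hn

/-- Cuspidality is constant on `≼`-classes of primary elements. [cite: MochizukiEtTh2009, Def 3.6 p.77] -/
theorem mem_csp₀_of_mem_carrier (hS : IsSharp (T.Φ₀.obj Y)) (𝔭 : Primes (T.Φ₀.obj Y))
    {e e' : T.Φ₀.obj Y} (he : e ∈ 𝔭.carrier) (he' : e' ∈ 𝔭.carrier) (hc : e ∈ T.csp₀ Y) :
    e' ∈ T.csp₀ Y :=
  T.mem_csp₀_of_precsim Y hS (𝔭.precsim_of_mem_carrier he' he) hc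

/-- **Definition 3.6 (v)(b) at the level of `Φ₀(Y)`** (`Φ₀(Y)` sharp): every prime of `Φ₀(Y)` is
non-cuspidal (all its primary elements are) or cuspidal (all its primary elements are) …
[cite: MochizukiEtTh2009, Def 3.6 p.78] -/
theorem primes_ncsp_or_csp (hS : IsSharp (T.Φ₀.obj Y)) (𝔭 : Primes (T.Φ₀.obj Y)) :
    (∀ e ∈ 𝔭.carrier, e ∈ T.ncsp₀ Y) ∨ (∀ e ∈ 𝔭.carrier, e ∈ T.csp₀ Y) := by
  obtain ⟨⟨p, hp⟩, rfl⟩ := Quotient.exists_rep 𝔭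
  have hpc : p ∈ Primes.carrier (Quotient.mk (primarySetoid _) ⟨p, hp⟩) := ⟨hp, rfl⟩
  rcases T.mem_ncsp₀_or_mem_csp₀_of_isPrimary Y hS hp with h | h
  · exact Or.inl fun e he => T.mem_ncsp₀_of_mem_carrier Y hS _ hpc he h
  · exact Or.inr fun e he => T.mem_csp₀_of_mem_carrier Y hS _ hpc he h

/-- … and not both. [cite: MochizukiEtTh2009, Def 3.6 p.78] -/
theorem primes_not_ncsp_and_csp (𝔭 : Primes (T.Φ₀.obj Y)) :
    ¬ ((∀ e ∈ 𝔭.carrier, e ∈ T.ncsp₀ Y) ∧ (∀ e ∈ 𝔭.carrier, e ∈ T.csp₀ Y)) := by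
  rintro ⟨h₁, h₂⟩
  obtain ⟨⟨p, hp⟩, rfl⟩ := Quotient.exists_rep 𝔭
  have hpc : p ∈ Primes.carrier (Quotient.mk (primarySetoid _) ⟨p, hp⟩) := ⟨hp, rfl⟩
  exact hp.1 (T.eq_one_of_mem_ncsp₀_of_mem_csp₀ Y (h₁ p hpc) (h₂ p hpc))

/-- **Support characterisation of the non-cuspidal log-divisors** (`Φ₀(Y)` perf-factorial,
Prop 3.4 (i)): `x` is non-cuspidal iff every primary `y ≼ x` is — i.e. iff the support of `x` lies in
the special fibre (Def 3.1 (i)). [cite: MochizukiEtTh2009, Def 3.1 p.70] -/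
theorem mem_ncsp₀_iff_forall_isPrimary (hpf : IsPerfFactorial (T.Φ₀.obj Y)) (x : T.Φ₀.obj Y) :
    x ∈ T.ncsp₀ Y ↔ ∀ y : T.Φ₀.obj Y, IsPrimary y → Precsim y x → y ∈ T.ncsp₀ Y := by
  have hS := hpf.isDivisorial.isSharp
  refine ⟨fun hx y _ hyx => T.mem_ncsp₀_of_precsim Y hS hyx hx, fun H => ?_⟩
  obtain ⟨⟨a, c⟩, hac, -⟩ := T.existsUnique_ncsp_csp Y x
  by_cases hc : (c : T.Φ₀.obj Y) = 1
  · rw [← hac, hc, mul_one]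
    exact a.2
  · obtain ⟨m, hm, hmc⟩ := hpf.exists_isPrimary_precsim hc
    have hmx : Precsim m x := hmc.trans (Precsim.of_dvd ⟨a, by rw [← hac, mul_comm]⟩)
    exact absurd (T.eq_one_of_mem_ncsp₀_of_mem_csp₀ Y (H m hm hmx) (T.mem_csp₀_of_precsim Y hS hmc c.2))
      hm.1

/-- **Support characterisation of the cuspidal log-divisors** (`Φ₀(Y)` perf-factorial): `x` is
cuspidal iff every primary `y ≼ x` is (support in the divisor of cusps, Def 3.1 (i)).
[cite: MochizukiEtTh2009, Def 3.1 p.70] -/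
theorem mem_csp₀_iff_forall_isPrimary (hpf : IsPerfFactorial (T.Φ₀.obj Y)) (x : T.Φ₀.obj Y) :
    x ∈ T.csp₀ Y ↔ ∀ y : T.Φ₀.obj Y, IsPrimary y → Precsim y x → y ∈ T.csp₀ Y := by
  have hS := hpf.isDivisorial.isSharp
  refine ⟨fun hx y _ hyx => T.mem_csp₀_of_precsim Y hS hyx hx, fun H => ?_⟩
  obtain ⟨⟨a, c⟩, hac, -⟩ := T.existsUnique_ncsp_csp Y x
  by_cases ha : (a : T.Φ₀.obj Y) = 1
  · rw [← hac, ha, one_mul]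
    exact c.2
  · obtain ⟨m, hm, hma⟩ := hpf.exists_isPrimary_precsim ha
    have hmx : Precsim m x := hma.trans (Precsim.of_dvd ⟨c, hac.symm⟩)
    exact absurd (T.eq_one_of_mem_ncsp₀_of_mem_csp₀ Y (T.mem_ncsp₀_of_precsim Y hS hma a.2) (H m hm hmx))
      hm.1

end DivisorMonoids

end Literature.AnabelianGeometry.EtaleTheta
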